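import Literature.AlgebraicGeometry.Frobenioids.Cor54RigidityLinearSaturation
import Literature.AlgebraicGeometry.Frobenioids.Cor54RigidityArithDegreeBase
import Literature.AlgebraicGeometry.Frobenioids.Cor54RigidityArithSaturation
import Literature.AlgebraicGeometry.Frobenioids.DivSlimRealification
import HarnessLib

/-!
# Frobenioids I, Corollary 5.4 at `C_{K/F}` (row C54-core-arith, sub-row (4), assembly (A) modulo small
# realisations): a functorial self-map of the realification image fixes the identity-base linear morphisms

Mochizuki, *The geometry of Frobenioids I: the general theory*, Kyushu J. Math. **62** (2008) 293–400,
Cor. 5.4 p. 104 for THE realification (Prop. 5.3 p. 103) of the arithmetic Frobenioid `C_{K/F}` (Ex. 6.3 p. 113).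
[cite: MochizukiFrdI2008, Cor. 5.4 p.104] [cite: MochizukiFrdI2008, Ex. 6.3 p.113]

PROOF-ONLY (cell abc-iut, seat abc-iut-L1-d8; no definitions). Setting of `Cor54RigidityArithDegreeBase.lean`:
`G = (R.ofBaseData Ψ).functor` for THE realification data `R` of `Φ = arithDivisorFunctor F K` and a subfunctor
of groups `Ψ`, `ρ` a functorial self-map of the homs between `G`-image objects fixing the `G f`,
`k = (1, 𝟙_X, z, u) : G(X, γ) → G(X, γ')` identity-base linear, `ρ(k) = (1, 𝟙_X, ẑ, û)` (step (B1),
`degFr_base_rho_linear_arith`), `δ = ẑ - z`.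

* `FrdI.Cor54Sub.gpApp_toRlf_injective_arith` — `ι^gp : Φ(L)^gp → (Φ(L)^rlf)^gp` is injective;
* `FrdI.Cor54Sub.forall_zpow_delta_effective_arith_of_small` — **`c + n·δ` effective for all `n ∈ ℤ`** (whence
  `ρ(k) = k` by the squeeze, in the final file), GIVEN "small realisations" of the powers of
  the unit coordinate `u` (hypothesis `hsmall`, step (D1)): one `c ∈ Φ(L)^rlf` and, for every `n ≥ 1`,
  identity-base linear morphisms between image objects over `X` with unit coordinate `u^n`, resp. an inverse of
  `u^n`, whose zero divisor DIVIDES `c`.  Proof: by the cocycle identities (seat files `…LinearCocycle`,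
  `…LinearSaturation`: `exists_pow_unit`, `delta_eq_of_unit_eq`, `div_rho_comp_eq_of_unit_mul_eq_one`, with
  `hsat = toRlf_saturated_arith`) `c + n · δ` is effective for every `n ∈ ℤ`, so `δ = 0` by the coordinate
  squeeze `ArithRlfCoord.rlfGp_eq_one_of_forall_zpow_effective` (seat abc-iut-L1-d9); then `ẑ = z` and
  `ρ(k) = k` by `ModelFrobenioid.hom_eq_of_divB_injective` (`Div_B` of `ℝ·Ψ` is an inclusion).
Nothing here bears on [IUTchIII] Cor. 3.12.
-/

noncomputable section

namespace Literature.AlgebraicGeometry.Frobenioids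

namespace ModelFrobenioid.DataHom

open CategoryTheory Opposite

universe w v u

variable {D : Type u} [Category.{v} D] {Φ B Φ' B' : Dᵒᵖ ⥤ CommMonCat.{w}} {DivB : B ⟶ monoidGp Φ}
  {DivB' : B' ⟶ monoidGp Φ'} (h : DataHom DivB DivB')

/-- **Free translates.** An identity-base linear `k = (1, 𝟙_A, z, u) : G(A, γ) → G(A, γ')` has, at every source
class `t`, the translate `(1, 𝟙_A, z, u) : G(A, t) → G(A, t + γ' - γ)` (relation (d) of Thm. 5.2 (i) is that of
`k`). [cite: MochizukiFrdI2008, Thm. 5.2(i) p.100] -/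
theorem exists_free_translate (A : D) (γ γ' : Algebra.GrothendieckGroup (Φ.obj (op A)))
    (k : h.functor.obj ⟨A, γ⟩ ⟶ h.functor.obj ⟨A, γ'⟩) (hd : degFr k = 1) (hb : baseMap k = 𝟙 A)
    (z : Φ'.obj (op A)) (uu : B'.obj (op A)) (hz : div k = z) (hu : unit k = uu)
    (t : Algebra.GrothendieckGroup (Φ.obj (op A))) :
    ∃ kt : h.functor.obj ⟨A, t⟩ ⟶ h.functor.obj ⟨A, t * (γ⁻¹ * γ')⟩,
      degFr kt = 1 ∧ baseMap kt = 𝟙 A ∧ div kt = z ∧ unit kt = uu := by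
  obtain ⟨d, f, z₁, u₁, hrel⟩ := k
  change ℕ+ at d
  change A ⟶ A at f
  change ↥(Φ'.obj (op A)) at z₁
  change ↥(B'.obj (op A)) at u₁
  change d = 1 at hd
  change f = 𝟙 A at hb
  change z₁ = z at hz
  change u₁ = uu at hu
  subst hd hb hz hu
  have hr : (gpApp h.η (op A) γ) ^ ((1 : ℕ+) : ℕ) * Algebra.GrothendieckGroup.of z₁ =
      pullGp Φ' (𝟙 A) (gpApp h.η (op A) γ') * divB Φ' B' DivB' (op A) u₁ := hrel
  rw [PNat.one_coe, pow_one, pullGp_id] at hr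
  have hzu : gpApp h.η (op A) (γ⁻¹ * γ') * divB Φ' B' DivB' (op A) u₁ = Algebra.GrothendieckGroup.of z₁ := by
    rw [map_mul, map_inv, mul_assoc]; exact (eq_inv_mul_of_mul_eq hr).symm
  exact ⟨⟨1, 𝟙 A, z₁, u₁, by
    show (gpApp h.η (op A) t) ^ ((1 : ℕ+) : ℕ) * Algebra.GrothendieckGroup.of z₁ =
      pullGp Φ' (𝟙 A) (gpApp h.η (op A) (t * (γ⁻¹ * γ'))) * divB Φ' B' DivB' (op A) u₁
    rw [PNat.one_coe, pow_one, pullGp_id, map_mul, mul_assoc, hzu]⟩, rfl, rfl, rfl, rfl⟩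

end ModelFrobenioid.DataHom

namespace FrdI.Cor54Sub

open CategoryTheory Opposite NumberField IsDedekindDomain Literature.IUT.LogVolume ModelFrobenioid

variable {F : Type} [Field F] [NumberField F] {K : Type} [Field K] [Algebra F K]

/-- `ι^gp : Φ(L)^gp → (Φ(L)^rlf)^gp` is injective at every `X` (`ι` injective into the cancellative `Φ(L)^rlf`).
[cite: MochizukiFrdI2008, Prop. 5.3 p.103] -/
theorem gpApp_toRlf_injective_arith
    (hΦ' : ∀ X : (FinSubextCat F K)ᵒᵖ, IsPerfFactorial ((arithDivisorFunctor F K).obj X))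
    (Ψ : GpSubfunctor (arithDivisorFunctor F K)) (X : FinSubextCat F K) :
    Function.Injective
      (gpApp ((RealificationData.canonical (arithDivisorFunctor F K) hΦ').ofBaseData Ψ).η (op X)) := by
  have hM : IsPerfFactorial (Multiplicative (EffArithDivisor X.L)) := hΦ' (op X)
  haveI : IsCancelMul hM.Rlf := IsPerfFactorial.Rlf.isCancelMul hM
  have hinj : Function.Injective
      (((RealificationData.canonical (arithDivisorFunctor F K) hΦ').toRlf.app (op X)).hom) := by
    rw [RealificationData.canonical_toRlf]
    exact toRlfNatTrans_app_injective (arithDivisorFunctor F K) hΦ' (op X)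
  intro q₁ q₂ hq
  obtain ⟨a₁, b₁, rfl⟩ := DataHom.exists_eq_of_div_of (Φ := arithDivisorFunctor F K) X q₁
  obtain ⟨a₂, b₂, rfl⟩ := DataHom.exists_eq_of_div_of (Φ := arithDivisorFunctor F K) X q₂
  rw [map_div, map_div, gpApp_of, gpApp_of, gpApp_of, gpApp_of, div_eq_div_iff_mul_eq_mul] at hq
  have hq' : Algebra.GrothendieckGroup.of (M := hM.Rlf)
      (hM.toRealification (Perfection.of _ a₁) * hM.toRealification (Perfection.of _ b₂)) =
      Algebra.GrothendieckGroup.of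
      (hM.toRealification (Perfection.of _ a₂) * hM.toRealification (Perfection.of _ b₁)) := by
    rw [map_mul, map_mul]; exact hq
  have h0 := Algebra.GrothendieckGroup.of_injective hq'
  have h1 : ((RealificationData.canonical (arithDivisorFunctor F K) hΦ').toRlf.app (op X)).hom (a₁ * b₂) =
      ((RealificationData.canonical (arithDivisorFunctor F K) hΦ').toRlf.app (op X)).hom (a₂ * b₁) := by
    rw [map_mul, map_mul]; exact h0
  have h2 := hinj h1
  rw [div_eq_div_iff_mul_eq_mul, ← map_mul, ← map_mul, h2]

/-- **(A) core: `c + n · δ(k)` is effective for every `n ∈ ℤ`** for identity-base linear `k` at `C_{K/F}`, given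
small realisations of the powers of `u_k` (see the module docstring); the coordinate squeeze then gives `δ(k) = 0`
and `ρ(k) = k` (`Cor54RigidityArithSqueeze`, final file). [cite: MochizukiFrdI2008, Cor. 5.4 p.104] -/
theorem forall_zpow_delta_effective_arith_of_small
    (hΦ' : ∀ X : (FinSubextCat F K)ᵒᵖ, IsPerfFactorial ((arithDivisorFunctor F K).obj X))
    (Ψ : GpSubfunctor (arithDivisorFunctor F K))
    (ρ : ∀ ⦃a a' : Ψ.ModelOf⦄,
      (((RealificationData.canonical _ hΦ').ofBaseData Ψ).functor.obj a ⟶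
        ((RealificationData.canonical _ hΦ').ofBaseData Ψ).functor.obj a') →
      (((RealificationData.canonical _ hΦ').ofBaseData Ψ).functor.obj a ⟶
        ((RealificationData.canonical _ hΦ').ofBaseData Ψ).functor.obj a'))
    (hcomp : ∀ ⦃a a' a'' : Ψ.ModelOf⦄
      (k : ((RealificationData.canonical _ hΦ').ofBaseData Ψ).functor.obj a ⟶
        ((RealificationData.canonical _ hΦ').ofBaseData Ψ).functor.obj a')
      (l : ((RealificationData.canonical _ hΦ').ofBaseData Ψ).functor.obj a' ⟶
        ((RealificationData.canonical _ hΦ').ofBaseData Ψ).functor.obj a''), ρ (k ≫ l) = ρ k ≫ ρ l)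
    (hmap : ∀ ⦃a a' : Ψ.ModelOf⦄ (f : a ⟶ a'),
      ρ (((RealificationData.canonical _ hΦ').ofBaseData Ψ).functor.map f) =
        ((RealificationData.canonical _ hΦ').ofBaseData Ψ).functor.map f)
    (X : FinSubextCat F K) (γ γ' : Algebra.GrothendieckGroup ((arithDivisorFunctor F K).obj (op X)))
    (k : ((RealificationData.canonical _ hΦ').ofBaseData Ψ).functor.obj ⟨X, γ⟩ ⟶
      ((RealificationData.canonical _ hΦ').ofBaseData Ψ).functor.obj ⟨X, γ'⟩)
    (hd : degFr k = 1) (hb : baseMap k = 𝟙 X)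
    (uu : ((RealificationData.canonical (arithDivisorFunctor F K) hΦ').realSpan Ψ).toMonoid.obj (op X))
    (hu : unit k = uu)
    (hsmall : ∃ c : (RealificationData.canonical (arithDivisorFunctor F K) hΦ').rlf.obj (op X), ∀ n : ℕ,
      (∃ (γ₁ γ₁' : Algebra.GrothendieckGroup ((arithDivisorFunctor F K).obj (op X)))
        (k₁ : ((RealificationData.canonical _ hΦ').ofBaseData Ψ).functor.obj ⟨X, γ₁⟩ ⟶
          ((RealificationData.canonical _ hΦ').ofBaseData Ψ).functor.obj ⟨X, γ₁'⟩)
        (z₁ e₁ : (RealificationData.canonical (arithDivisorFunctor F K) hΦ').rlf.obj (op X)),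
        degFr k₁ = 1 ∧ baseMap k₁ = 𝟙 X ∧ div k₁ = z₁ ∧ unit k₁ = uu ^ (n + 1) ∧ z₁ * e₁ = c) ∧
      (∃ (ui : ((RealificationData.canonical (arithDivisorFunctor F K) hΦ').realSpan Ψ).toMonoid.obj (op X))
        (γ₂ γ₂' : Algebra.GrothendieckGroup ((arithDivisorFunctor F K).obj (op X)))
        (k₂ : ((RealificationData.canonical _ hΦ').ofBaseData Ψ).functor.obj ⟨X, γ₂⟩ ⟶
          ((RealificationData.canonical _ hΦ').ofBaseData Ψ).functor.obj ⟨X, γ₂'⟩)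
        (z₂ e₂ : (RealificationData.canonical (arithDivisorFunctor F K) hΦ').rlf.obj (op X)),
        ui * uu ^ (n + 1) = 1 ∧ degFr k₂ = 1 ∧ baseMap k₂ = 𝟙 X ∧ div k₂ = z₂ ∧ unit k₂ = ui ∧
          z₂ * e₂ = c)) :
    ∃ (c zh z : (RealificationData.canonical (arithDivisorFunctor F K) hΦ').rlf.obj (op X)),
      div (ρ k) = zh ∧ div k = z ∧
      ∀ n : ℤ, ∃ e : (RealificationData.canonical (arithDivisorFunctor F K) hΦ').rlf.obj (op X),
        Algebra.GrothendieckGroup.of c *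
          (Algebra.GrothendieckGroup.of zh * (Algebra.GrothendieckGroup.of z)⁻¹) ^ n =
        Algebra.GrothendieckGroup.of e := by
  classical
  have hM : IsPerfFactorial (Multiplicative (EffArithDivisor X.L)) := hΦ' (op X)
  haveI : IsCancelMul hM.Rlf := IsPerfFactorial.Rlf.isCancelMul hM
  haveI : IsCancelMul ((RealificationData.canonical (arithDivisorFunctor F K) hΦ').rlf.obj (op X)) := IsPerfFactorial.Rlf.isCancelMul hM
  have hι := gpApp_toRlf_injective_arith hΦ' Ψ X
  have hsat := toRlf_saturated_arith hΦ' Ψ X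
  have hB1 : ∀ (β β' : Algebra.GrothendieckGroup ((arithDivisorFunctor F K).obj (op X)))
      (k' : ((RealificationData.canonical (arithDivisorFunctor F K) hΦ').ofBaseData Ψ).functor.obj ⟨X, β⟩ ⟶ ((RealificationData.canonical (arithDivisorFunctor F K) hΦ').ofBaseData Ψ).functor.obj ⟨X, β'⟩),
      degFr k' = 1 → baseMap k' = 𝟙 X → degFr (ρ k') = 1 ∧ baseMap (ρ k') = 𝟙 X :=
    fun β β' k' hd' hb' => degFr_base_rho_linear_arith hΦ' Ψ ρ hcomp hmap X β β' k' hd' hb'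
  -- casts of the components of `k` and `ρ k`
  obtain ⟨z, hz⟩ : ∃ z : ↥((RealificationData.canonical (arithDivisorFunctor F K) hΦ').rlf.obj (op X)), div k = z := ⟨_, rfl⟩
  obtain ⟨zh, hρz⟩ : ∃ zh : ↥((RealificationData.canonical (arithDivisorFunctor F K) hΦ').rlf.obj (op X)), div (ρ k) = zh := ⟨_, rfl⟩
  obtain ⟨c, hc⟩ := hsmall
  obtain ⟨c', hcc⟩ : ∃ c' : ↥((RealificationData.canonical (arithDivisorFunctor F K) hΦ').rlf.obj (op X)), c' = c := ⟨_, rfl⟩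
  subst hcc
  refine ⟨c', zh, z, hρz, hz, fun n => ?_⟩
  -- the composite realisation `Kₘ` of `u^m` with `δ(Kₘ) = m δ` (cocycle (c5)), cast to `Φ(L)^rlf`
  have hK : ∀ m : ℕ, ∃ (t : Algebra.GrothendieckGroup ((arithDivisorFunctor F K).obj (op X)))
      (Kn : ((RealificationData.canonical (arithDivisorFunctor F K) hΦ').ofBaseData Ψ).functor.obj ⟨X, γ⟩ ⟶ ((RealificationData.canonical (arithDivisorFunctor F K) hΦ').ofBaseData Ψ).functor.obj ⟨X, t⟩) (zK cK : ↥((RealificationData.canonical (arithDivisorFunctor F K) hΦ').rlf.obj (op X))),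
      degFr Kn = 1 ∧ baseMap Kn = 𝟙 X ∧ div Kn = zK ∧ unit Kn = uu ^ (m + 1) ∧ div (ρ Kn) = cK ∧
      Algebra.GrothendieckGroup.of cK * Algebra.GrothendieckGroup.of z ^ (m + 1) =
        Algebra.GrothendieckGroup.of zh ^ (m + 1) * Algebra.GrothendieckGroup.of zK := by
    intro m
    obtain ⟨t, Kn, zK, cK, hKd, hKb, hKz, hKu, hKc, hid⟩ :=
      DataHom.exists_pow_unit ((RealificationData.canonical (arithDivisorFunctor F K) hΦ').ofBaseData Ψ) ρ hcomp hmap X hι hB1 γ γ' k z uu hd hb hz hu zh hρz (m + 1)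
        (by omega)
    exact ⟨t, Kn, zK, cK, hKd, hKb, hKz, hKu, hKc, hid⟩
  rcases Int.eq_nat_or_neg n with ⟨m, rfl | rfl⟩
  · cases m with
    | zero =>
      refine ⟨c', ?_⟩
      show Algebra.GrothendieckGroup.of c' * (Algebra.GrothendieckGroup.of zh * (Algebra.GrothendieckGroup.of z)⁻¹) ^ ((0 : ℕ) : ℤ) = Algebra.GrothendieckGroup.of c'
      simp only [Nat.cast_zero, zpow_zero, mul_one]
    | succ m =>
      obtain ⟨⟨γ₁, γ₁', k₁, z₁', e₁', hd₁, hb₁, hz₁, hu₁, hze⟩, -⟩ := hc m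
      obtain ⟨z₁, hz₁'⟩ : ∃ z₁ : ↥((RealificationData.canonical (arithDivisorFunctor F K) hΦ').rlf.obj (op X)), z₁ = z₁' := ⟨_, rfl⟩
      obtain ⟨e₁, he₁'⟩ : ∃ e₁ : ↥((RealificationData.canonical (arithDivisorFunctor F K) hΦ').rlf.obj (op X)), e₁ = e₁' := ⟨_, rfl⟩
      subst hz₁' he₁'
      have hze' : z₁ * e₁ = c' := hze
      obtain ⟨t, Kn, zK, cK, hKd, hKb, hKz, hKu, hKc, hid⟩ := hK m
      obtain ⟨c₁, hc₁⟩ : ∃ c₁ : ↥((RealificationData.canonical (arithDivisorFunctor F K) hΦ').rlf.obj (op X)), div (ρ k₁) = c₁ := ⟨_, rfl⟩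
      -- `δ(k₁) = δ(Kₘ)`: same unit coordinate (cocycle (c4′))
      have E : Algebra.GrothendieckGroup.of cK * Algebra.GrothendieckGroup.of z₁ =
          Algebra.GrothendieckGroup.of c₁ * Algebra.GrothendieckGroup.of zK :=
        DataHom.delta_eq_of_unit_eq ((RealificationData.canonical (arithDivisorFunctor F K) hΦ').ofBaseData Ψ) ρ hcomp hmap X hι hB1 γ t γ₁ γ₁' Kn k₁ zK z₁
          (uu ^ (m + 1)) hKd hKb hKz hKu hd₁ hb₁ hz₁ hu₁ cK c₁ hKc hc₁
      refine ⟨e₁ * c₁, ?_⟩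
      show Algebra.GrothendieckGroup.of c' * (Algebra.GrothendieckGroup.of zh * (Algebra.GrothendieckGroup.of z)⁻¹) ^ ((m + 1 : ℕ) : ℤ) = Algebra.GrothendieckGroup.of (e₁ * c₁)
      have hcz : Algebra.GrothendieckGroup.of c' =
          Algebra.GrothendieckGroup.of z₁ * Algebra.GrothendieckGroup.of e₁ := by
        rw [← hze', map_mul]
      apply mul_right_cancel (b := Algebra.GrothendieckGroup.of zK *
        Algebra.GrothendieckGroup.of z ^ (m + 1))
      rw [zpow_natCast, mul_pow, inv_pow, hcz, map_mul]
      calc Algebra.GrothendieckGroup.of z₁ * Algebra.GrothendieckGroup.of e₁ *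
            (Algebra.GrothendieckGroup.of zh ^ (m + 1) * (Algebra.GrothendieckGroup.of z ^ (m + 1))⁻¹) *
            (Algebra.GrothendieckGroup.of zK * Algebra.GrothendieckGroup.of z ^ (m + 1))
          = Algebra.GrothendieckGroup.of z₁ * Algebra.GrothendieckGroup.of e₁ *
            (Algebra.GrothendieckGroup.of zh ^ (m + 1) * Algebra.GrothendieckGroup.of zK) *
            ((Algebra.GrothendieckGroup.of z ^ (m + 1))⁻¹ * Algebra.GrothendieckGroup.of z ^ (m + 1)) := by ac_rfl
        _ = Algebra.GrothendieckGroup.of e₁ *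
            (Algebra.GrothendieckGroup.of cK * Algebra.GrothendieckGroup.of z₁) *
            Algebra.GrothendieckGroup.of z ^ (m + 1) := by rw [inv_mul_cancel, mul_one, ← hid]; ac_rfl
        _ = Algebra.GrothendieckGroup.of e₁ *
            (Algebra.GrothendieckGroup.of c₁ * Algebra.GrothendieckGroup.of zK) *
            Algebra.GrothendieckGroup.of z ^ (m + 1) := by rw [E]
        _ = Algebra.GrothendieckGroup.of e₁ * Algebra.GrothendieckGroup.of c₁ *
            (Algebra.GrothendieckGroup.of zK * Algebra.GrothendieckGroup.of z ^ (m + 1)) := by ac_rfl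
  · cases m with
    | zero =>
      refine ⟨c', ?_⟩
      show Algebra.GrothendieckGroup.of c' * (Algebra.GrothendieckGroup.of zh * (Algebra.GrothendieckGroup.of z)⁻¹) ^ (-((0 : ℕ) : ℤ)) = Algebra.GrothendieckGroup.of c'
      simp only [Nat.cast_zero, neg_zero, zpow_zero, mul_one]
    | succ m =>
      obtain ⟨-, ⟨ui, γ₂, γ₂', k₂, z₂', e₂', hui, hd₂, hb₂, hz₂, hu₂, hze⟩⟩ := hc m
      obtain ⟨z₂, hz₂'⟩ : ∃ z₂ : ↥((RealificationData.canonical (arithDivisorFunctor F K) hΦ').rlf.obj (op X)), z₂ = z₂' := ⟨_, rfl⟩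
      obtain ⟨e₂, he₂'⟩ : ∃ e₂ : ↥((RealificationData.canonical (arithDivisorFunctor F K) hΦ').rlf.obj (op X)), e₂ = e₂' := ⟨_, rfl⟩
      subst hz₂' he₂'
      have hze' : z₂ * e₂ = c' := hze
      obtain ⟨t, Kn, zK, cK, hKd, hKb, hKz, hKu, hKc, hid⟩ := hK m
      obtain ⟨hρKd, hρKb⟩ := hB1 _ _ Kn hKd hKb
      -- the free translate of `k₂` to the source `t`
      obtain ⟨kt, hktd, hktb, hktz, hktu⟩ := DataHom.exists_free_translate ((RealificationData.canonical (arithDivisorFunctor F K) hΦ').ofBaseData Ψ) X γ₂ γ₂' k₂ hd₂ hb₂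
        z₂ ui hz₂ hu₂ t
      obtain ⟨hρtd, hρtb⟩ := hB1 _ _ kt hktd hktb
      obtain ⟨ct, hct⟩ : ∃ ct : ↥((RealificationData.canonical (arithDivisorFunctor F K) hΦ').rlf.obj (op X)), div (ρ kt) = ct := ⟨_, rfl⟩
      obtain ⟨uK, huK⟩ : ∃ uK : (((RealificationData.canonical (arithDivisorFunctor F K) hΦ').realSpan Ψ).toMonoid.obj (op X)), unit (ρ Kn) = uK := ⟨_, rfl⟩
      obtain ⟨ut, hut⟩ : ∃ ut : (((RealificationData.canonical (arithDivisorFunctor F K) hΦ').realSpan Ψ).toMonoid.obj (op X)), unit (ρ kt) = ut := ⟨_, rfl⟩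
      -- `δ(kt) + δ(Kₘ) = 0` (cocycle (c7))
      have E0 := DataHom.div_rho_comp_eq_of_unit_mul_eq_one ((RealificationData.canonical (arithDivisorFunctor F K) hΦ').ofBaseData Ψ) ρ hcomp hmap X hι hsat γ t _ Kn
        kt zK z₂ cK ct (uu ^ (m + 1)) ui uK ut hKd hKb hKz hKu hktd hktb hktz hktu hρKd hρKb hKc huK hρtd
        hρtb hct hut hui
      have E0' : ct * cK = z₂ * zK := E0
      have E : Algebra.GrothendieckGroup.of ct * Algebra.GrothendieckGroup.of cK =
          Algebra.GrothendieckGroup.of z₂ * Algebra.GrothendieckGroup.of zK := by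
        rw [← map_mul, ← map_mul, E0']
      refine ⟨e₂ * ct, ?_⟩
      show Algebra.GrothendieckGroup.of c' * (Algebra.GrothendieckGroup.of zh * (Algebra.GrothendieckGroup.of z)⁻¹) ^ (-((m + 1 : ℕ) : ℤ)) = Algebra.GrothendieckGroup.of (e₂ * ct)
      have hcz : Algebra.GrothendieckGroup.of c' =
          Algebra.GrothendieckGroup.of z₂ * Algebra.GrothendieckGroup.of e₂ := by
        rw [← hze', map_mul]
      apply mul_right_cancel (b := Algebra.GrothendieckGroup.of cK *
        Algebra.GrothendieckGroup.of zh ^ (m + 1))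
      rw [zpow_neg, zpow_natCast, mul_pow, inv_pow, mul_inv_rev, inv_inv, hcz, map_mul]
      calc Algebra.GrothendieckGroup.of z₂ * Algebra.GrothendieckGroup.of e₂ *
            (Algebra.GrothendieckGroup.of z ^ (m + 1) * (Algebra.GrothendieckGroup.of zh ^ (m + 1))⁻¹) *
            (Algebra.GrothendieckGroup.of cK * Algebra.GrothendieckGroup.of zh ^ (m + 1))
          = Algebra.GrothendieckGroup.of z₂ * Algebra.GrothendieckGroup.of e₂ *
            (Algebra.GrothendieckGroup.of cK * Algebra.GrothendieckGroup.of z ^ (m + 1)) *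
            ((Algebra.GrothendieckGroup.of zh ^ (m + 1))⁻¹ * Algebra.GrothendieckGroup.of zh ^ (m + 1)) := by
              ac_rfl
        _ = Algebra.GrothendieckGroup.of e₂ *
            (Algebra.GrothendieckGroup.of z₂ * Algebra.GrothendieckGroup.of zK) *
            Algebra.GrothendieckGroup.of zh ^ (m + 1) := by rw [inv_mul_cancel, mul_one, hid]; ac_rfl
        _ = Algebra.GrothendieckGroup.of e₂ *
            (Algebra.GrothendieckGroup.of ct * Algebra.GrothendieckGroup.of cK) *
            Algebra.GrothendieckGroup.of zh ^ (m + 1) := by rw [E]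
        _ = Algebra.GrothendieckGroup.of e₂ * Algebra.GrothendieckGroup.of ct *
            (Algebra.GrothendieckGroup.of cK * Algebra.GrothendieckGroup.of zh ^ (m + 1)) := by ac_rfl

end FrdI.Cor54Sub

end Literature.AlgebraicGeometry.Frobenioids
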